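import Mathlib
import HarnessLib
import Summits.ValiantsHypothesis.ValiantsHypothesis.Theses.MonotoneRestoration
import Literature.Computability.AlgebraicComplexity.ArithCircuit
import Literature.Computability.AlgebraicComplexity.ArithCircuitProofs
import Literature.Computability.AlgebraicComplexity.MonotoneStructure
import Literature.Computability.AlgebraicComplexity.PermanentIrreducible
import Literature.ModelTheory.FiniteModelTheory.CkEquiv
import Summits.ValiantsHypothesis.ValiantsHypothesis.Theorems.MonotoneRestorationMonotoneRestorationQPCosetCount
import Summits.ValiantsHypothesis.ValiantsHypothesis.Theorems.MonotoneRestorationMonotoneRestorationQPSymmetricLB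
import Summits.ValiantsHypothesis.ValiantsHypothesis.Theorems.MonotoneRestorationMonotoneRestorationQPSupportSymmetrisation
import Summits.ValiantsHypothesis.ValiantsHypothesis.Theorems.MonotoneRestorationMonotoneRestorationQPSparseRegime
import Summits.ValiantsHypothesis.ValiantsHypothesis.Theorems.MonotoneRestorationMonotoneRestorationQPBeta
import Literature.Computability.AlgebraicComplexity.SymmetricArithCircuit
import Literature.Computability.AlgebraicComplexity.DawarWilsenach2025Proofs
import Literature.GroupTheory.PermutationGroups.SmallIndexSubgroups
import Summits.ValiantsHypothesis.ValiantsHypothesis.Theorems.MonotoneRestorationQP.Negative.LoadBearing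
import Summits.ValiantsHypothesis.ValiantsHypothesis.Theorems.MonotoneRestorationMonotoneRestorationQPPermSupportCount

/-! TTRL-lite variant V19889 of stmt-ValiantsHypothesis-15886 -/

-- `Summit.ValiantsHypothesis.ValiantsHypothesis.…` is the tree's mandated single-conjunct layout
-- (Sub = Summit), so the duplicated namespace component is intended.
set_option linter.dupNamespace false

namespace Summit.ValiantsHypothesis.ValiantsHypothesis.Theorems

open Summit.ValiantsHypothesis.ValiantsHypothesis.Theses.MonotoneRestoration
open Literature.Computability.AlgebraicComplexity

/-- TTRL-lite variant V19889 of `stmt-ValiantsHypothesis-15886`: a gate-free arithmetic circuit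
computes a leaf — its value is a variable `X i` or a constant `C c` (a junk gate reference against
the empty value list evaluates to `0 = C 0`). -/
theorem stub_monotoneComputation_of_complexity_var19889 :
    ∀ (σ : Type) (P : ArithCircuit NNReal σ), P.size = 0 →
      (∃ i : σ, P.eval = MvPolynomial.X i) ∨ ∃ c : NNReal, P.eval = MvPolynomial.C c := by
  intro σ P hP
  have hg : P.gates = [] := List.length_eq_zero_iff.mp hP
  obtain ⟨gates, output⟩ := P
  subst hg
  cases output with
  | var i => exact Or.inl ⟨i, rfl⟩
  | const c => exact Or.inr ⟨c, rfl⟩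
  | gate j =>
    refine Or.inr ⟨0, ?_⟩
    simp [ArithCircuit.eval, ArithCircuit.Operand.eval, ArithCircuit.gateValues]

end Summit.ValiantsHypothesis.ValiantsHypothesis.Theorems
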